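import Summits.AtomisticToContinuum.HydrodynamicLimit.Theses.JParityClosure
import Summits.AtomisticToContinuum.HydrodynamicLimit.Theorems.JParityClosureLocalSecondLawInitialLayerLLN
import Summits.AtomisticToContinuum.HydrodynamicLimit.Theorems.ImplosionDichotomyHsEosLowDensity
import HarnessLib

/-!
# ANATOMY of the line `entropy-floor-fixes-energy` (crux `JParityClosure.ParityBandClosure`, stmt-AtomisticToContinuum-17608):
# the summit conjunct IMPLIES the fixed-time entropy floor — `_root_.HydrodynamicLimit → EntropyNoDipAt`

Registered sub-goal `stub_entropyNoDipAtOfHydrodynamicLimit`. The skeleton-local waypoint `EntropyNoDipAt` (the line's one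
new dynamical input; skeleton `Cruxes/ParityBandClosure/Lines/entropy_floor_fixes_energy.lean`) is re-declared VERBATIM and
shown to FOLLOW from the packing-guarded summit conjunct `_root_.HydrodynamicLimit` (`Statement.lean`) — the converse of
the line's lever `stub_energyFloorOfEntropyFloor` (floor ⇒ energy third at `t`): modulo the landed density third and the
momentum third at `t`, the floor is EQUIVALENT to the energy third at `t` (gap G1) — G1 in entropy currency, NOT a stronger
statement (correcting the skeleton docstring). PROOF (soft: mollification at FIXED `r` is compact): `uniformLLN_at` —
`TendstoHydroFieldsAt … t` ⇒ fixed-`r` UNIFORM-IN-`x` LLN of the cone fields at time `t` (the landed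
`LocalSecondLawLedger.initialLayer_uniformLLN` with `0 ↦ t`: finite net, centre-Lipschitz cone fields with the
energy-tight constant from the `χ ≡ 1` energy tie AT `t`); Heine–Cantor on two compact boxes (`continuousOn_thetaMap`,
`continuousOn_HsPair` — `f_ex` continuous on `[0, η_E/2]` by the landed `hsEosLowDensity_proof`; `thetaMap_classical`)
⇒ off an event of probability `≤ δ`, `|Hs(ρ,θ)(t,x) − Hs(ρ_r,θ_r)(x)| < κ := η/(C_ψθ_M+1)` at every `x` ⇒ the weighted
dip integral is `≥ −κC_ψθ_M > −η` if integrable and the junk `0 > −η` otherwise: the dip event lies in the bad event.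
Thresholds `η₀ := min η₀ᴴᴸ (η_E/4)`, `σ₀ := min σ₀ᴴᴸ (min 1 (η_E/4))`. References: H. Spohn, *Large Scale Dynamics of
Interacting Particles* (1991), Part I §3; C. Kipnis, C. Landim, *Scaling Limits of Interacting Particle Systems* (1999), Ch. 4.
-/

noncomputable section

namespace Summit.AtomisticToContinuum.HydrodynamicLimit.Theorems.ParityBandClosureEntropyNoDipAtAnatomy

open scoped BigOperators Topology Classical MeasureTheory ENNReal InnerProductSpace
open Filter Set MeasureTheory
open Literature.MathematicalPhysics.KineticTheory
open Literature.Analysis.FluidPDE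
open Summit.AtomisticToContinuum.HydrodynamicLimit.Theses
open Summit.AtomisticToContinuum.HydrodynamicLimit.Theorems.LocalSecondLawNegative
open Summit.AtomisticToContinuum.HydrodynamicLimit.Theorems.LocalSecondLawLedger

/-! ## §1 The fixed-`r` uniform-in-`x` law of large numbers at time `t` -/

/-- **Uniform-in-`x` LLN for the cone fields at time `t`**: under `TendstoHydroFieldsAt … t` with continuous data
`(ρ, u, θ)(t, ·)`, for `r < r₀(ε)` and eventually in `N`, off an event of law-probability `≤ δ` the three cone fields of
`Φ_t z` are `ε`-close to `(ρ, ρu, E)(t, x)` at EVERY centre `x` (`initialLayer_uniformLLN` with `0 ↦ t`). [folklore] -/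
theorem uniformLLN_at :
  ∀ {σ : ℝ} {a₀ θ₀ : T3 → ℝ} {u₀ : T3 → V3} {ρ θ : ℝ → T3 → ℝ} {u : ℝ → T3 → V3} {t : ℝ},
    Continuous (ρ t) → Continuous (u t) → Continuous (θ t) →
    ∀ Φ : (N : ℕ) → Flow σ N, TendstoHydroFieldsAt (fun N => localGibbsLaw σ a₀ u₀ θ₀ N (Φ N)) Φ ρ u θ t →
    ∀ {ε δ : ℝ}, 0 < ε → 0 < δ → ∃ r₀ : ℝ, 0 < r₀ ∧ ∀ r : ℝ, 0 < r → r < r₀ → ∃ N₀ : ℕ, ∀ N : ℕ, N₀ ≤ N →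
      ∃ B : Set (Phase N), localGibbsLaw σ a₀ u₀ θ₀ N (Φ N) B ≤ ENNReal.ofReal δ ∧
        ∀ z, z ∉ B → ∀ x : T3,
          |rhoC r ((Φ N).flow t z) x - ρ t x| < ε ∧
          ‖momC r ((Φ N).flow t z) x - ρ t x • u t x‖ < ε ∧
          |kinC r ((Φ N).flow t z) x - totalEnergyDensity (ρ t x) (u t x) (θ t x)| < ε := by
  intro σ a₀ θ₀ u₀ ρ θ u t hρc huc hθc Φ h0 ε δ hε hδ
  -- the data and their uniform continuity at scale `ε/4`
  have hEc : Continuous fun x => totalEnergyDensity (ρ t x) (u t x) (θ t x) := by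
    unfold totalEnergyDensity; fun_prop
  have hMc : Continuous fun x => ρ t x • u t x := hρc.smul huc
  have hε4 : 0 < ε / 4 := by positivity
  obtain ⟨δ₁, hδ₁, H1⟩ := initL_unifCont hρc hε4
  obtain ⟨δ₂, hδ₂, H2⟩ := initL_unifCont hMc hε4
  obtain ⟨δ₃, hδ₃, H3⟩ := initL_unifCont hEc hε4
  have hδD : 0 < min δ₁ (min δ₂ δ₃) := lt_min hδ₁ (lt_min hδ₂ hδ₃)
  have HD : ∀ x y : T3, Torus.euclidDist x y < min δ₁ (min δ₂ δ₃) →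
      |ρ t x - ρ t y| < ε / 4 ∧ ‖ρ t x • u t x - ρ t y • u t y‖ < ε / 4 ∧
      |totalEnergyDensity (ρ t x) (u t x) (θ t x) - totalEnergyDensity (ρ t y) (u t y) (θ t y)| < ε / 4 :=
    fun x y hxy =>
      ⟨H1 x y (hxy.trans_le (min_le_left _ _)),
        H2 x y (hxy.trans_le ((min_le_right _ _).trans (min_le_left _ _))),
        H3 x y (hxy.trans_le ((min_le_right _ _).trans (min_le_right _ _)))⟩
  refine ⟨min (min δ₁ (min δ₂ δ₃)) (1 / 2), lt_min hδD one_half_pos, fun r hr hrr₀ => ?_⟩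
  have hrδ : r < min δ₁ (min δ₂ δ₃) := hrr₀.trans_le (min_le_left _ _)
  have hr2 : r ≤ 1 / 2 := (hrr₀.trans_le (min_le_right _ _)).le
  -- cone averages of the data are `ε/4`-close to the data, at every centre
  have HA : ∀ y : T3, |(∫ x, cone r x y * ρ t x) - ρ t y| ≤ ε / 4 ∧
      ‖(∫ x, (cone r x y * ρ t x) • u t x) - ρ t y • u t y‖ ≤ ε / 4 ∧
      |(∫ x, cone r x y * totalEnergyDensity (ρ t x) (u t x) (θ t x)) -
        totalEnergyDensity (ρ t y) (u t y) (θ t y)| ≤ ε / 4 := by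
    intro y
    refine ⟨initL_coneAvg hρc hr hr2 y fun x hx => (HD x y (hx.trans hrδ)).1.le, ?_,
      initL_coneAvg hEc hr hr2 y fun x hx => (HD x y (hx.trans hrδ)).2.2.le⟩
    have h : (fun x => (cone r x y * ρ t x) • u t x) = fun x => cone r x y • (ρ t x • u t x) := by
      funext x; rw [mul_smul]
    rw [h]
    exact initL_coneAvg hMc hr hr2 y fun x hx => (HD x y (hx.trans hrδ)).2.1.le
  -- constants at fixed `r`, mesh, net
  set L : ℝ := 3 / (Real.pi * r ^ 4)
  have hLpos : 0 < L := by positivity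
  set IE : ℝ := ∫ x, (1 : ℝ) * totalEnergyDensity (ρ t x) (u t x) (θ t x)
  set K : ℝ := |IE| + 1 with hK
  have hK1 : 1 ≤ K := by have := abs_nonneg IE; linarith
  have hL'pos : 0 < L * (1 + K) := by positivity
  set m : ℝ := min (min δ₁ (min δ₂ δ₃) / 2) (ε / (4 * (L * (1 + K))))
  have hmpos : 0 < m := lt_min (by positivity) (by positivity)
  have hmδ : m < min δ₁ (min δ₂ δ₃) := (min_le_left _ _).trans_lt (half_lt_self hδD)
  have hmL : L * (1 + K) * m ≤ ε / 4 := by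
    calc L * (1 + K) * m ≤ L * (1 + K) * (ε / (4 * (L * (1 + K)))) :=
          mul_le_mul_of_nonneg_left (min_le_right _ _) hL'pos.le
      _ = ε / 4 := by field_simp
  obtain ⟨Sx, hSx⟩ := gridUp_euclidNet hmpos
  -- the bad events
  set P : (N : ℕ) → Measure (Phase N) := fun N => localGibbsLaw σ a₀ u₀ θ₀ N (Φ N)
  set A1 : (N : ℕ) → T3 → Set (Phase N) := fun N y =>
    {z | ε / 4 < |empiricalDensityField ((Φ N).flow t z) (fun x => cone r x y) - ∫ x, cone r x y * ρ t x|}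
  set A2 : (N : ℕ) → T3 → Set (Phase N) := fun N y =>
    {z | ε / 4 < ‖empiricalMomentumField ((Φ N).flow t z) (fun x => cone r x y) -
      ∫ x, (cone r x y * ρ t x) • u t x‖}
  set A3 : (N : ℕ) → T3 → Set (Phase N) := fun N y =>
    {z | ε / 4 < |empiricalEnergyField ((Φ N).flow t z) (fun x => cone r x y) -
      ∫ x, cone r x y * totalEnergyDensity (ρ t x) (u t x) (θ t x)|}
  set AE : (N : ℕ) → Set (Phase N) := fun N =>
    {z | 1 < |empiricalEnergyField ((Φ N).flow t z) (fun _ => 1) - IE|}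
  have hA : ∀ y : T3, Tendsto (fun N => P N (A1 N y) + P N (A2 N y) + P N (A3 N y)) atTop (𝓝 0) := by
    intro y
    obtain ⟨h1, h2, h3⟩ := h0 (fun x => cone r x y) (densMod_continuous_cone r y) (ε / 4) hε4
    have h := (h1.add h2).add h3
    rw [add_zero, add_zero] at h
    exact h
  have hAE' : Tendsto (fun N => P N (AE N)) atTop (𝓝 0) :=
    (h0 (fun _ => (1 : ℝ)) continuous_const 1 one_pos).2.2
  set f : ℕ → ENNReal := fun N => (∑ y ∈ Sx, (P N (A1 N y) + P N (A2 N y) + P N (A3 N y))) + P N (AE N)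
  have hfT : Tendsto f atTop (𝓝 0) := by
    have hsum := tendsto_finsetSum Sx fun y (_ : y ∈ Sx) => hA y
    rw [Finset.sum_const_zero] at hsum
    simpa only [add_zero] using hsum.add hAE'
  obtain ⟨N₀, hN₀⟩ := eventually_atTop.1 ((tendsto_order.1 hfT).2 _ (ENNReal.ofReal_pos.2 hδ))
  refine ⟨N₀, fun N hN => ⟨(⋃ y ∈ Sx, (A1 N y ∪ A2 N y ∪ A3 N y)) ∪ AE N, ?_, ?_⟩⟩
  · calc P N ((⋃ y ∈ Sx, (A1 N y ∪ A2 N y ∪ A3 N y)) ∪ AE N)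
        ≤ P N (⋃ y ∈ Sx, (A1 N y ∪ A2 N y ∪ A3 N y)) + P N (AE N) := measure_union_le _ _
      _ ≤ (∑ y ∈ Sx, P N (A1 N y ∪ A2 N y ∪ A3 N y)) + P N (AE N) :=
          add_le_add (measure_biUnion_finset_le Sx _) le_rfl
      _ ≤ f N := by
          refine add_le_add (Finset.sum_le_sum fun y _ => ?_) le_rfl
          exact (measure_union_le _ _).trans (add_le_add (measure_union_le _ _) le_rfl)
      _ ≤ ENNReal.ofReal δ := (hN₀ N hN).le
  · intro z hz x
    have memU : ∀ y ∈ Sx, ∀ {S : T3 → Set (Phase N)}, z ∈ S y → z ∈ ⋃ y ∈ Sx, S y :=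
      fun y hy S h => Set.mem_iUnion.2 ⟨y, Set.mem_iUnion.2 ⟨hy, h⟩⟩
    obtain ⟨y, hy, hxy⟩ := hSx x
    set w := (Φ N).flow t z
    -- energy bound off `AE`
    have hEn : empiricalEnergyField w (fun _ => 1) ≤ K := by
      have h1 : ¬ (1 < |empiricalEnergyField w (fun _ => 1) - IE|) := fun h => hz (Or.inr h)
      have h2 := le_abs_self (empiricalEnergyField w (fun _ => 1) - IE)
      have h3 := le_abs_self IE
      rw [hK]; linarith [not_lt.1 h1]
    have hE0 := initL_energy_nonneg w
    -- the LLN at the net point `y`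
    have e1 : |rhoC r w y - ∫ x, cone r x y * ρ t x| ≤ ε / 4 :=
      not_lt.1 fun h => hz (Or.inl (memU y hy (S := fun y => A1 N y ∪ A2 N y ∪ A3 N y) (Or.inl (Or.inl h))))
    have e2 : ‖momC r w y - ∫ x, (cone r x y * ρ t x) • u t x‖ ≤ ε / 4 :=
      not_lt.1 fun h => hz (Or.inl (memU y hy (S := fun y => A1 N y ∪ A2 N y ∪ A3 N y) (Or.inl (Or.inr h))))
    have e3 : |kinC r w y - ∫ x, cone r x y * totalEnergyDensity (ρ t x) (u t x) (θ t x)| ≤ ε / 4 :=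
      not_lt.1 fun h => hz (Or.inl (memU y hy (S := fun y => A1 N y ∪ A2 N y ∪ A3 N y) (Or.inr h)))
    -- Lipschitz from `x` to the net point
    obtain ⟨l1, l2, l3⟩ := initL_fields_lip hr w x y
    have hd0 : 0 ≤ Torus.euclidDist x y := norm_nonneg _
    have hLd : L * Torus.euclidDist x y * (1 + K) ≤ ε / 4 :=
      le_trans (by nlinarith [mul_le_mul_of_nonneg_left hxy hLpos.le]) hmL
    have l1' : |rhoC r w x - rhoC r w y| ≤ ε / 4 := l1.trans (by nlinarith)
    have l2' : ‖momC r w x - momC r w y‖ ≤ ε / 4 := l2.trans (by nlinarith)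
    have l3' : |kinC r w x - kinC r w y| ≤ ε / 4 := l3.trans (by nlinarith)
    -- uniform continuity of the data from the net point back to `x`
    obtain ⟨d1, d2, d3⟩ := HD y x (by rw [Torus.euclidDist_comm]; exact hxy.trans_lt hmδ)
    obtain ⟨a1, a2, a3⟩ := HA y
    exact ⟨initL_chain_abs l1' e1 a1 d1, initL_chain l2' e2 a2 d2, initL_chain_abs l3' e3 a3 d3⟩


/-! ## §2 Continuity of the entropy density on compact boxes; the waypoint (verbatim); the theorem -/

/-- The coarse-temperature map `(a, m, e) ↦ (2/3)(e/a − ‖m‖²/(2a²))` (`thetaC` at the cone fields, definitionally)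
returns `θ` at the classical conserved variables `(ρ, ρu, E)`, `E = ρ(‖u‖²/2 + 3θ/2)`, `ρ ≠ 0`. [folklore] -/
theorem thetaMap_classical {ρ θ : ℝ} (hρ : ρ ≠ 0) (u : V3) :
    2 / 3 * (totalEnergyDensity ρ u θ / ρ - ‖ρ • u‖ ^ 2 / (2 * ρ ^ 2)) = θ := by
  unfold totalEnergyDensity
  rw [norm_smul, mul_pow, Real.norm_eq_abs, sq_abs]
  field_simp
  ring

/-- **The entropy density `(a, b) ↦ Hs σ a b` is continuous on a compact box inside the regular range**
`[a₁, a₂] × [b₁, b₂]`, `0 < a₁`, `0 < b₁`, provided `f_ex` is continuous on `[0, ηb] ∋ a σ³` for `a ≤ a₂`. [folklore] -/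
theorem continuousOn_HsPair {σ a₁ a₂ b₁ b₂ ηb : ℝ} (hσ : 0 ≤ σ) (ha₁ : 0 < a₁) (hb₁ : 0 < b₁)
    (hband : a₂ * σ ^ 3 ≤ ηb) (hf : ContinuousOn hsExcessFreeEnergy (Set.Icc 0 ηb)) :
    ContinuousOn (fun p : ℝ × ℝ => Hs σ p.1 p.2) (Set.Icc a₁ a₂ ×ˢ Set.Icc b₁ b₂) := by
  set B : Set (ℝ × ℝ) := Set.Icc a₁ a₂ ×ˢ Set.Icc b₁ b₂
  have hpos : ∀ p ∈ B, 0 < p.1 ∧ 0 < p.2 := fun p hp =>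
    ⟨ha₁.trans_le (Set.mem_prod.1 hp).1.1, hb₁.trans_le (Set.mem_prod.1 hp).2.1⟩
  have hG : ContinuousOn
      (fun p : ℝ × ℝ => -(p.1 * (3 / 2 * Real.log p.2 - Real.log p.1 - hsExcessFreeEnergy (p.1 * σ ^ 3)))) B := by
    refine ContinuousOn.neg (continuous_fst.continuousOn.mul (ContinuousOn.sub (ContinuousOn.sub ?_ ?_) ?_))
    · exact continuousOn_const.mul (continuous_snd.continuousOn.log fun p hp => (hpos p hp).2.ne')
    · exact continuous_fst.continuousOn.log fun p hp => (hpos p hp).1.ne'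
    · refine hf.comp (continuous_fst.mul continuous_const).continuousOn fun p hp => ?_
      exact ⟨mul_nonneg (hpos p hp).1.le (pow_nonneg hσ 3),
        (mul_le_mul_of_nonneg_right (Set.mem_prod.1 hp).1.2 (pow_nonneg hσ 3)).trans hband⟩
  refine hG.congr fun p hp => ?_
  show Hs σ p.1 p.2 = -(p.1 * (3 / 2 * Real.log p.2 - Real.log p.1 - hsExcessFreeEnergy (p.1 * σ ^ 3)))
  unfold Hs
  rw [if_pos (hpos p hp)]

/-- **The skeleton-local waypoint `EntropyNoDipAt`, VERBATIM** (skeleton v2 of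
`Cruxes/ParityBandClosure/Lines/entropy_floor_fixes_energy.lean`, same `open`s; re-declared only because `Lines/` files are
never imported, so that the registered header `stub_entropyNoDipAtOfHydrodynamicLimit : _root_.HydrodynamicLimit →
EntropyNoDipAt` is matched by name + signature; syntactically identical ⇒ definitionally equal). FIXED-TIME LOCAL ENTROPY
FLOOR: at a fixed `t ∈ [0,T)`, for every continuous `ψ ≥ 0`, the `ψθ(t,·)`-weighted hard-sphere field entropy of the
`r`-cone-mollified empirical fields is, with local-Gibbs probability `≥ 1 − δ`, not more than `η` BELOW its classical value
(`N → ∞` at fixed `r < r₀(η,δ)`); `Hs = −S_σ`, `ρm`, `mm`, `em`, `θm` exactly as in `JParityClosure.LocalSecondLaw`. -/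
def EntropyNoDipAt : Prop :=
  ∃ η₀ : ℝ, 0 < η₀ ∧ ∀ (a₀ θ₀ : T3 → ℝ) (u₀ : T3 → V3), Continuous a₀ → Continuous θ₀ → Continuous u₀ →
    (∀ x, 0 < a₀ x) → (∀ x, 0 < θ₀ x) → ∃ σ₀ : ℝ, 0 < σ₀ ∧ ∀ σ : ℝ, 0 < σ → σ < σ₀ →
    ∀ (T : ℝ) (ρ θ : ℝ → T3 → ℝ) (u : ℝ → T3 → V3), IsHardSphereEulerSolution σ T ρ u θ →
    (∀ t ∈ Set.Ico 0 T, ∀ x, ρ t x * σ ^ 3 < η₀) →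
    ∀ Φ : (N : ℕ) → HardSphereFlow (Torus.geometry (Fin 3)) (hsDiameter σ N) (N + 1),
    TendstoHydroFieldsAt (fun N => localGibbsLaw σ a₀ u₀ θ₀ N (Φ N)) Φ ρ u θ 0 →
    ∀ t ∈ Set.Ico 0 T, ∀ ψ : T3 → ℝ, Continuous ψ → (∀ x, 0 ≤ ψ x) → ∀ η δ : ℝ, 0 < η → 0 < δ →
    ∃ r₀ : ℝ, 0 < r₀ ∧ ∀ r : ℝ, 0 < r → r < r₀ → ∃ N₀ : ℕ, ∀ N : ℕ, N₀ ≤ N →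
    let bx : T3 → T3 → ℝ := fun x y => 3 / (Real.pi * r ^ 3) * max (1 - Torus.euclidDist x y / r) 0
    let ρm : Config (N + 1) (Fin 3) T3 → T3 → ℝ := fun w x₀ => ∫ q, bx q.1 x₀ ∂(empiricalMeasure w)
    let mm : Config (N + 1) (Fin 3) T3 → T3 → V3 := fun w x₀ => ∫ q, bx q.1 x₀ • q.2 ∂(empiricalMeasure w)
    let em : Config (N + 1) (Fin 3) T3 → T3 → ℝ := fun w x₀ =>
      ∫ q, bx q.1 x₀ * (‖q.2‖ ^ 2 / 2) ∂(empiricalMeasure w)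
    let θm : Config (N + 1) (Fin 3) T3 → T3 → ℝ := fun w x₀ =>
      2 / 3 * (em w x₀ / ρm w x₀ - ‖mm w x₀‖ ^ 2 / (2 * ρm w x₀ ^ 2))
    let Hs : ℝ → ℝ → ℝ := fun a b =>
      if 0 < a ∧ 0 < b then -(a * (3 / 2 * Real.log b - Real.log a - hsExcessFreeEnergy (a * σ ^ 3))) else 0
    localGibbsLaw σ a₀ u₀ θ₀ N (Φ N)
      {z | (∫ x : T3, ψ x * θ t x *
          (Hs (ρ t x) (θ t x) - Hs (ρm ((Φ N).flow t z) x) (θm ((Φ N).flow t z) x))) < -η} ≤ ENNReal.ofReal δ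

/-- **ANATOMY: the summit conjunct implies the fixed-time entropy floor** (registered sub-goal of the line
`entropy-floor-fixes-energy`). `η₀ := min η₀ᴴᴸ (η_E/4)`, `σ₀ := min σ₀ᴴᴸ (min 1 (η_E/4))`; at the instant `t`:
`TendstoHydroFieldsAt … t` (guard inherited) ⇒ `uniformLLN_at` ⇒ off an event of probability `≤ δ` the cone fields are
uniformly `ε`-close to `(ρ, ρu, E)(t,·)` ⇒ (Heine–Cantor on two compact boxes, `continuousOn_HsPair`, `thetaMap_classical`)
`|Hs(ρ,θ)(t,x) − Hs(ρ_r,θ_r)(x)| < κ := η/(C_ψθ_M + 1)` for all `x` ⇒ `|∫ψθ(…)| ≤ κC_ψθ_M < η` (a bound that needs no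
integrability: `norm_integral_le_of_norm_le_const`), so the dip event lies in the bad event. [folklore] -/
theorem stub_entropyNoDipAtOfHydrodynamicLimit : _root_.HydrodynamicLimit → EntropyNoDipAt := by
  rintro ⟨ηH, hηH, HH⟩
  obtain ⟨ηE, hηE, F, hFan, hFeq, -⟩ := Summit.AtomisticToContinuum.HydrodynamicLimit.Theorems.hsEosLowDensity_proof
  have hfex : ContinuousOn hsExcessFreeEnergy (Set.Icc 0 (ηE / 2)) := by
    have hsub : Set.Icc 0 (ηE / 2) ⊆ Set.Ico 0 ηE := fun a ha => ⟨ha.1, by linarith [ha.2]⟩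
    exact (hFan.continuousOn.mono (hsub.trans (Set.Ico_subset_Ioo_left (by linarith)))).congr
      fun a ha => hFeq (hsub ha)
  refine ⟨min ηH (ηE / 4), lt_min hηH (by positivity), fun a₀ θ₀ u₀ ha hθ hu ha0 hθ0 => ?_⟩
  obtain ⟨σH, hσH, HHσ⟩ := HH a₀ θ₀ u₀ ha hθ hu ha0 hθ0
  refine ⟨min σH (min 1 (ηE / 4)), lt_min hσH (lt_min one_pos (by positivity)), ?_⟩
  intro σ hσ hσlt T ρ θ u hsol hguard Φ htie t ht ψ hψ hψ0 η δ hη hδ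
  have hσ3 : σ ^ 3 ≤ ηE / 4 := by
    have hσ1 : σ ≤ 1 := (hσlt.trans_le ((min_le_right _ _).trans (min_le_left _ _))).le
    have h1 : σ ^ 3 ≤ σ := by simpa using pow_le_pow_of_le_one hσ.le hσ1 (show 1 ≤ 3 by norm_num)
    exact h1.trans (hσlt.trans_le ((min_le_right _ _).trans (min_le_right _ _))).le
  have hσ3pos : 0 < σ ^ 3 := pow_pos hσ 3
  -- the conjunct at time `t`
  have hLLN : TendstoHydroFieldsAt (fun N => localGibbsLaw σ a₀ u₀ θ₀ N (Φ N)) Φ ρ u θ t :=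
    HHσ σ hσ (hσlt.trans_le (min_le_left _ _)) T ρ θ u hsol
      (fun s hs x => (hguard s hs x).trans_le (min_le_left _ _)) Φ htie t ht
  -- the classical data at time `t`: continuity, positive minima, bounds
  have hρc : Continuous (ρ t) := (hsol.smooth_density.isSmooth_slice ht).continuous
  have huc : Continuous (u t) := (hsol.smooth_velocity.isSmooth_slice ht).continuous
  have hθc : Continuous (θ t) := (hsol.smooth_temperature.isSmooth_slice ht).continuous
  have hρpos : ∀ x, 0 < ρ t x := hsol.density_pos t ht
  have hθpos : ∀ x, 0 < θ t x := hsol.temperature_pos t ht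
  have hEc : Continuous fun x => totalEnergyDensity (ρ t x) (u t x) (θ t x) := by
    unfold totalEnergyDensity; fun_prop
  obtain ⟨xρ, -, hxρ⟩ := isCompact_univ.exists_isMinOn Set.univ_nonempty hρc.continuousOn
  obtain ⟨xθ, -, hxθ⟩ := isCompact_univ.exists_isMinOn Set.univ_nonempty hθc.continuousOn
  set ρmin : ℝ := ρ t xρ
  set θmin : ℝ := θ t xθ
  have hρmin : ∀ x, ρmin ≤ ρ t x := fun x => hxρ (Set.mem_univ x)
  have hθmin : ∀ x, θmin ≤ θ t x := fun x => hxθ (Set.mem_univ x)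
  have hρmin0 : 0 < ρmin := hρpos xρ
  have hθmin0 : 0 < θmin := hθpos xθ
  set ρM : ℝ := min ηH (ηE / 4) / σ ^ 3 with hρM_def
  have hρM : ∀ x, ρ t x ≤ ρM := fun x => by
    rw [hρM_def, le_div_iff₀ hσ3pos]
    exact (hguard t ht x).le
  have hband : (ρM + 1) * σ ^ 3 ≤ ηE / 2 := by
    have : ρM * σ ^ 3 = min ηH (ηE / 4) := by rw [hρM_def, div_mul_cancel₀ _ hσ3pos.ne']
    nlinarith [min_le_right ηH (ηE / 4)]
  obtain ⟨θM, hθM0, hθM⟩ := exists_forall_abs_le_of_continuous hθc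
  obtain ⟨MM, -, hMM⟩ := exists_forall_abs_le_of_continuous (χ := fun x => ‖ρ t x • u t x‖) (hρc.smul huc).norm
  obtain ⟨EM, -, hEM⟩ := exists_forall_abs_le_of_continuous hEc
  obtain ⟨Cψ, hCψ0, hCψ⟩ := exists_forall_abs_le_of_continuous hψ
  have hθle : ∀ x, θ t x ≤ θM := fun x => (le_abs_self _).trans (hθM x)
  have hMle : ∀ x, ‖ρ t x • u t x‖ ≤ MM := fun x => (le_abs_self _).trans (hMM x)
  -- the tolerance `κ`
  set κ : ℝ := η / (Cψ * θM + 1) with hκ_def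
  have hCθ : 0 ≤ Cψ * θM := mul_nonneg hCψ0 hθM0
  have hκ : 0 < κ := by positivity
  have hκη : κ * (Cψ * θM) < η := by
    rw [hκ_def, div_mul_eq_mul_div, div_lt_iff₀ (by positivity)]
    nlinarith
  -- Stage 2: uniform continuity of `Hs` on the box `B2`
  set B2 : Set (ℝ × ℝ) := Set.Icc (ρmin / 2) (ρM + 1) ×ˢ Set.Icc (θmin / 2) (θM + 1)
  have hB2c : IsCompact B2 := isCompact_Icc.prod isCompact_Icc
  have hH2 : ContinuousOn (fun p : ℝ × ℝ => Hs σ p.1 p.2) B2 :=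
    continuousOn_HsPair (a₁ := ρmin / 2) (b₁ := θmin / 2) hσ.le (by positivity) (by positivity) hband hfex
  obtain ⟨δ₂, hδ₂, Hδ₂⟩ := Metric.uniformContinuousOn_iff.1 (hB2c.uniformContinuousOn_of_continuous hH2) κ hκ
  -- Stage 1: uniform continuity of the coarse-temperature map `Θ` on the box `B1`
  set κ₁ : ℝ := min (δ₂ / 2) (min (θmin / 2) 1)
  have hκ₁ : 0 < κ₁ := lt_min (by positivity) (lt_min (by positivity) one_pos)
  have hκ₁δ : κ₁ ≤ δ₂ / 2 := min_le_left _ _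
  have hκ₁θ : κ₁ ≤ θmin / 2 := (min_le_right _ _).trans (min_le_left _ _)
  have hκ₁1 : κ₁ ≤ 1 := (min_le_right _ _).trans (min_le_right _ _)
  set B1 : Set (ℝ × V3 × ℝ) :=
    Set.Icc (ρmin / 2) (ρM + 1) ×ˢ (Metric.closedBall (0 : V3) (MM + 1) ×ˢ Set.Icc (-(EM + 1)) (EM + 1))
  set Θ : ℝ × V3 × ℝ → ℝ := fun p => 2 / 3 * (p.2.2 / p.1 - ‖p.2.1‖ ^ 2 / (2 * p.1 ^ 2))
  have hΘ : ContinuousOn Θ B1 := by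
    have hne : ∀ p ∈ B1, p.1 ≠ 0 := fun p hp =>
      ne_of_gt (lt_of_lt_of_le (by positivity) (Set.mem_prod.1 hp).1.1)
    refine continuousOn_const.mul (ContinuousOn.sub ?_ ?_)
    · exact continuous_snd.snd.continuousOn.div continuous_fst.continuousOn hne
    · exact ((continuous_snd.fst.norm.pow 2).continuousOn).div
        (continuousOn_const.mul (continuous_fst.pow 2).continuousOn) fun p hp =>
          mul_ne_zero two_ne_zero (pow_ne_zero 2 (hne p hp))
  have hB1c : IsCompact B1 := isCompact_Icc.prod ((isCompact_closedBall _ _).prod isCompact_Icc)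
  obtain ⟨ε₁, hε₁, Hε₁⟩ := Metric.uniformContinuousOn_iff.1 (hB1c.uniformContinuousOn_of_continuous hΘ) κ₁ hκ₁
  -- the LLN tolerance `ε` and the uniform LLN at time `t`
  set ε : ℝ := min (min ε₁ (δ₂ / 2)) (min (ρmin / 2) 1)
  have hε : 0 < ε := lt_min (lt_min hε₁ (by positivity)) (lt_min (by positivity) one_pos)
  have hεε₁ : ε ≤ ε₁ := (min_le_left _ _).trans (min_le_left _ _)
  have hεδ : ε ≤ δ₂ / 2 := (min_le_left _ _).trans (min_le_right _ _)
  have hερ : ε ≤ ρmin / 2 := (min_le_right _ _).trans (min_le_left _ _)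
  have hε1 : ε ≤ 1 := (min_le_right _ _).trans (min_le_right _ _)
  obtain ⟨r₀, hr₀, Hr⟩ := uniformLLN_at hρc huc hθc Φ hLLN hε hδ
  refine ⟨r₀, hr₀, fun r hr hrr₀ => ?_⟩
  obtain ⟨N₀, HN⟩ := Hr r hr hrr₀
  refine ⟨N₀, fun N hN => ?_⟩
  obtain ⟨B, hPB, hgood⟩ := HN N hN
  refine le_trans (measure_mono fun z hz => ?_) hPB
  by_contra hzB
  set w : Config (N + 1) (Fin 3) T3 := (Φ N).flow t z
  -- pointwise closeness of the entropy densities off the bad event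
  have hpt : ∀ x, |Hs σ (ρ t x) (θ t x) - Hs σ (rhoC r w x) (thetaC r w x)| < κ := by
    intro x
    obtain ⟨h1, h2, h3⟩ := hgood z hzB x
    have h1' := abs_sub_lt_iff.1 h1
    have h3' := abs_sub_lt_iff.1 h3
    have hEx := abs_le.1 (hEM x)
    have hm : ‖momC r w x‖ ≤ MM + 1 := by
      linarith [norm_sub_norm_le (momC r w x) (ρ t x • u t x), hMle x]
    set p : ℝ × V3 × ℝ := (rhoC r w x, momC r w x, kinC r w x)
    set q : ℝ × V3 × ℝ := (ρ t x, ρ t x • u t x, totalEnergyDensity (ρ t x) (u t x) (θ t x))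
    have hq : q ∈ B1 := Set.mem_prod.2 ⟨⟨by linarith [hρmin x], by linarith [hρM x]⟩, Set.mem_prod.2
      ⟨by rw [Metric.mem_closedBall, dist_zero_right]; linarith [hMle x], by linarith [hEx.1], by linarith [hEx.2]⟩⟩
    have hp : p ∈ B1 := Set.mem_prod.2 ⟨⟨by linarith [hρmin x], by linarith [hρM x]⟩, Set.mem_prod.2
      ⟨by rw [Metric.mem_closedBall, dist_zero_right]; exact hm, by linarith [hEx.1], by linarith [hEx.2]⟩⟩
    have hpq : dist p q < ε₁ := by
      rw [Prod.dist_eq, Prod.dist_eq, Real.dist_eq, Real.dist_eq, dist_eq_norm]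
      exact lt_of_lt_of_le (max_lt h1 (max_lt h2 h3)) hεε₁
    have hθ1 : dist (Θ p) (Θ q) < κ₁ := Hε₁ p hp q hq hpq
    have e1 : Θ p = thetaC r w x := rfl
    have e2 : Θ q = θ t x := thetaMap_classical (hρpos x).ne' (u t x)
    rw [e1, e2, Real.dist_eq] at hθ1
    have hθ1' := abs_sub_lt_iff.1 hθ1
    have hq2 : (ρ t x, θ t x) ∈ B2 :=
      Set.mem_prod.2 ⟨⟨by linarith [hρmin x], by linarith [hρM x]⟩, ⟨by linarith [hθmin x], by linarith [hθle x]⟩⟩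
    have hp2 : (rhoC r w x, thetaC r w x) ∈ B2 :=
      Set.mem_prod.2 ⟨⟨by linarith [hρmin x], by linarith [hρM x]⟩, ⟨by linarith [hθmin x], by linarith [hθle x]⟩⟩
    have hpq2 : dist (rhoC r w x, thetaC r w x) (ρ t x, θ t x) < δ₂ := by
      rw [Prod.dist_eq, Real.dist_eq, Real.dist_eq]
      exact max_lt (by linarith [h1]) (by linarith [hθ1])
    have hH := Hδ₂ _ hp2 _ hq2 hpq2
    rw [Real.dist_eq] at hH
    rwa [abs_sub_comm]
  -- the weighted dip integral has absolute value `≤ κ C_ψ θ_M < η` (no integrability needed)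
  have hz' : (∫ x : T3, ψ x * θ t x * (Hs σ (ρ t x) (θ t x) - Hs σ (rhoC r w x) (thetaC r w x))) < -η := hz
  have hbd : ∀ x, ‖ψ x * θ t x * (Hs σ (ρ t x) (θ t x) - Hs σ (rhoC r w x) (thetaC r w x))‖ ≤ κ * (Cψ * θM) := by
    intro x
    rw [Real.norm_eq_abs, abs_mul, abs_mul, abs_of_pos (hθpos x)]
    have h1 : |ψ x| * θ t x ≤ Cψ * θM := mul_le_mul (hCψ x) (hθle x) (hθpos x).le hCψ0
    calc |ψ x| * θ t x * |Hs σ (ρ t x) (θ t x) - Hs σ (rhoC r w x) (thetaC r w x)| ≤ Cψ * θM * κ :=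
          mul_le_mul h1 (hpt x).le (abs_nonneg _) hCθ
      _ = κ * (Cψ * θM) := by ring
  have hI := norm_integral_le_of_norm_le_const (μ := (volume : Measure T3)) (Eventually.of_forall hbd)
  rw [probReal_univ, mul_one, Real.norm_eq_abs] at hI
  linarith [neg_abs_le (∫ x : T3, ψ x * θ t x * (Hs σ (ρ t x) (θ t x) - Hs σ (rhoC r w x) (thetaC r w x))), hκη]

end Summit.AtomisticToContinuum.HydrodynamicLimit.Theorems.ParityBandClosureEntropyNoDipAtAnatomy

end
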